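/-
Copyright (c) 2026. All rights reserved.
Released under Apache 2.0 license as described in the file LICENSE.
Authors: abc-iut cell, prover seat abc-iut-L6-t14 (wave 2, generation 2).
-/
import Literature.RingTheory.MvPowerSeries.AdicEvaluation
import Literature.RingTheory.HenselLemma.NewtonContraction
import Mathlib.LinearAlgebra.Matrix.Adjugate
import HarnessLib

/-!
# Hensel's lemma for square POWER-SERIES systems with a non-invertible Jacobian ("positive slope")

Topic `Literature/RingTheory/HenselLemma` (proofs only). The sibling `PositiveSlope.lean` treats
polynomial systems; this file proves the same statement for formal power series
`S_j ∈ A⟦X_i : i ∈ m⟧` over an `I`-adically complete ring `A`, evaluated at points of `I^m` by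
adic evaluation (`Literature.RingTheory.MvPowerSeries.adicEval`), and along a chosen set of
directions `ι : n ↪ m` (the other variables being frozen at `0`): with `J_{jk}` the coefficient of
`X_{ι k}` in `S_j` and `d = det J` — NOT assumed to be a unit — for every `η ∈ Iⁿ` there is
`z ∈ Iⁿ` with `S_j(d·z placed in the directions ι) = S_j(0) + d²·η_j`
(`exists_adicEval_eq_det_sq`). This is Bourbaki, *Alg. Comm.* III §4 no. 5, Théorème 2
(`f(a + e·h(y)) = f(a) + M_f(a)·e·y`, formula (20), with `a = 0`, `e = d`, `y = M'·η` where
`M_f M' = e·1`, formula (23)) for formal rather than restricted power series at topologically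
nilpotent arguments, i.e. the "positive slope" Hensel lemma of [AbsTopII] Lemma 2.1 in Taylor
form.

Proof: the printed one. Write `S_j = S_j(0) + Σ_i c_{ji} X_i + Q_j` with `Q_j` of order `≥ 2`
and `Q_j(d·X) = d² Q♯_j(X)` coefficientwise (`Q♯_j = Σ_e (Q_j)_e d^{|e|-2} X^e`); the map
`T z = adj(J)(η - Q♯(z))` preserves `Iⁿ` and is contracting (`Q♯` has order `≥ 2`:
`MvPowerSeries.adicEval_sub_adicEval_mem_pow_succ`), so it has a fixed point
(`NewtonContraction.existsUnique_fixedPoint_of_contracting`), at which `J z = d(η - Q♯(z))` and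
hence `S(d z) = S(0) + d·J z + d² Q♯(z) = S(0) + d² η`. Nothing is asserted; everything is proved.
-/

noncomputable section

namespace Literature.RingTheory.HenselLemma

open _root_.MvPowerSeries Matrix Literature.RingTheory.MvPowerSeries

variable {A : Type*} [CommRing A] {I : Ideal A}

/-- **Hensel's lemma for square power-series systems with arbitrary Jacobian determinant, Taylor
form, along chosen directions.** Let `A` be `I`-adically complete, `S_j ∈ A⟦X_i : i ∈ m⟧`
(`j ∈ n`), `ι : n ↪ m`, `J_{jk} := coeff_{X_{ι k}} S_j`, `d := det J`. For every `η ∈ Iⁿ` there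
is `z ∈ Iⁿ` such that, writing `w ∈ A^m` for the vector with `w_{ι k} = d·z_k` and `w_i = 0` off
the image of `ι`, `S_j(w) = S_j(0) + d²·η_j` for all `j` (adic evaluation).
[cite: Bourbaki1989CommAlg, Ch. III §4 no. 5 Thm. 2] -/
theorem exists_adicEval_eq_det_sq [IsAdicComplete I A] {n m : Type*} [Fintype n]
    [DecidableEq n] [Fintype m] [DecidableEq m] (S : n → MvPowerSeries m A) (ι : n ↪ m)
    (η : n → A) (hη : ∀ j, η j ∈ I) :
    ∃ z : n → A, (∀ k, z k ∈ I) ∧ ∀ j,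
      adicEval I (fun i => if h : ∃ k, ι k = i then
          (Matrix.of fun j k : n => coeff (Finsupp.single (ι k) 1) (S j)).det * z h.choose else 0)
        (S j) =
      constantCoeff (S j) +
        (Matrix.of fun j k : n => coeff (Finsupp.single (ι k) 1) (S j)).det ^ 2 * η j := by
  classical
  set J : Matrix n n A := Matrix.of fun j k => coeff (Finsupp.single (ι k) 1) (S j) with hJ
  set d : A := J.det with hd
  -- extension by zero of a vector along the directions `ι`
  let ext : (n → A) → (m → A) := fun w i => if h : ∃ k, ι k = i then w h.choose else 0
  have hchoose : ∀ k, (⟨k, rfl⟩ : ∃ k', ι k' = ι k).choose = k := fun k =>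
    ι.injective (⟨k, rfl⟩ : ∃ k', ι k' = ι k).choose_spec
  have hext_ι : ∀ w k, ext w (ι k) = w k := by
    intro w k
    simp only [ext, dif_pos (⟨k, rfl⟩ : ∃ k', ι k' = ι k), hchoose]
  have hext_off : ∀ w i, (¬ ∃ k, ι k = i) → ext w i = 0 := by
    intro w i hi
    simp only [ext, dif_neg hi]
  have hextI : ∀ {K : Ideal A} (w : n → A), (∀ k, w k ∈ K) → ∀ i, ext w i ∈ K := by
    intro K w hw i
    by_cases hi : ∃ k, ι k = i
    · simp only [ext, dif_pos hi]; exact hw _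
    · rw [hext_off w i hi]; exact K.zero_mem
  have hext_sub : ∀ w w' i, ext w i - ext w' i = ext (w - w') i := by
    intro w w' i
    by_cases hi : ∃ k, ι k = i
    · simp only [ext, dif_pos hi, Pi.sub_apply]
    · simp only [ext, dif_neg hi, sub_zero]
  have hext_smul : ∀ (c : A) w, ext (c • w) = c • ext w := by
    intro c w
    funext i
    by_cases hi : ∃ k, ι k = i
    · simp only [ext, dif_pos hi, Pi.smul_apply, smul_eq_mul]
    · simp only [ext, dif_neg hi, Pi.smul_apply, smul_eq_mul, mul_zero]
  -- order-`≥ 2` parts `Q_j` and their rescalings `Q♯_j`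
  let Q : n → MvPowerSeries m A := fun j =>
    S j - C (constantCoeff (S j)) - ∑ i, C (coeff (Finsupp.single i 1) (S j)) * X i
  have hQcoeff : ∀ j e, coeff e (Q j) =
      if e.degree < 2 then 0 else coeff e (S j) := by
    intro j e
    simp only [Q, map_sub, map_sum, coeff_C_mul, coeff_X, coeff_C]
    by_cases h0 : e = 0
    · subst h0
      have hne : ∀ x : m, (0 : m →₀ ℕ) ≠ Finsupp.single x 1 := fun x h => by
        have := DFunLike.congr_fun h x
        simp at this
      simp [hne]
    · rw [if_neg h0, sub_zero]
      by_cases h1 : ∃ i, e = Finsupp.single i 1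
      · obtain ⟨i, rfl⟩ := h1
        rw [Finset.sum_eq_single i]
        · simp
        · intro i' _ hi'
          rw [if_neg (fun h => hi' (Finsupp.single_left_injective one_ne_zero h).symm), mul_zero]
        · intro hi; exact absurd (Finset.mem_univ i) hi
      · push Not at h1
        rw [Finset.sum_eq_zero (fun i _ => by rw [if_neg (h1 i), mul_zero]), sub_zero]
        have h2 : ¬ e.degree < 2 := by
          intro hlt
          have hle1 : e.degree ≤ 1 := by omega
          rcases Nat.le_one_iff_eq_zero_or_eq_one.mp hle1 with h | h
          · exact h0 ((Finsupp.degree_eq_zero_iff e).mp h)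
          · -- degree one: `e = single i 1`
            obtain ⟨i, hi⟩ : ∃ i, e i ≠ 0 := by
              by_contra hc
              push Not at hc
              exact h0 (Finsupp.ext hc)
            have hei : e i = 1 := by
              have := Finsupp.le_degree i e
              omega
            apply h1 i
            ext s
            by_cases hs : s = i
            · subst hs; rw [Finsupp.single_eq_same, hei]
            · rw [Finsupp.single_eq_of_ne hs]
              have := Finsupp.le_degree s e
              have hsum : e.degree = ∑ t, e t := Finsupp.degree_eq_sum e
              -- all other coordinates vanish since the degree is `1 = e i`
              by_contra hne
              have h2le : e i + e s ≤ e.degree := by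
                rw [hsum, ← Finset.sum_pair (Ne.symm hs)]
                exact Finset.sum_le_sum_of_subset_of_nonneg (Finset.subset_univ _)
                  (fun _ _ _ => Nat.zero_le _)
              omega
        rw [if_neg h2]
  have hQlow : ∀ j e, e.degree < 2 → coeff e (Q j) = 0 := fun j e he => by
    rw [hQcoeff, if_pos he]
  let Qs : n → MvPowerSeries m A := fun j e => coeff e (Q j) * d ^ (e.degree - 2)
  have hQs : ∀ j e, coeff e (Qs j) = coeff e (Q j) * d ^ (e.degree - 2) := fun j e => rfl
  have hQslow : ∀ j e, e.degree < 2 → coeff e (Qs j) = 0 := fun j e he => by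
    rw [hQs, hQlow j e he, zero_mul]
  have hQQs : ∀ j e, coeff e (Q j) * d ^ e.degree = d ^ 2 * coeff e (Qs j) := by
    intro j e
    by_cases he : e.degree < 2
    · rw [hQlow j e he, hQslow j e he, zero_mul, mul_zero]
    · rw [hQs, mul_left_comm, ← pow_add, Nat.add_sub_cancel' (not_lt.mp he)]
  -- the contracting map
  let T : (n → A) → (n → A) := fun z => adjugate J *ᵥ (η - fun j => adicEval I (ext z) (Qs j))
  have hT₀ : ∀ c : n → A, (∀ p, c p ∈ I) → ∀ p, T c p ∈ I := by
    intro c hc p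
    refine mulVec_mem (adjugate J) (fun j => I.sub_mem (hη j) ?_) p
    have := adicEval_mem_pow_of_coeff_eq_zero (I := I) (hextI c hc) (N := 1)
      (f := Qs j) (fun e he => hQslow j e (by omega))
    rwa [pow_one] at this
  have hT : ∀ (r : ℕ) (c c' : n → A), (∀ p, c p ∈ I) → (∀ p, c' p ∈ I) →
      (∀ p, c p - c' p ∈ I ^ r) → ∀ p, T c p - T c' p ∈ I ^ (r + 1) := by
    intro r c c' hc hc' hcc' p
    have hsub : T c - T c' =
        adjugate J *ᵥ fun j => adicEval I (ext c') (Qs j) - adicEval I (ext c) (Qs j) := by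
      simp only [T]
      rw [← Matrix.mulVec_sub]
      congr 1
      funext j
      simp only [Pi.sub_apply]
      ring
    rw [← Pi.sub_apply, hsub]
    refine mulVec_mem (adjugate J) (fun j => ?_) p
    exact adicEval_sub_adicEval_mem_pow_succ (hextI c' hc') (hextI c hc) (hQslow j)
      (fun i => by rw [hext_sub]; exact hextI (c' - c) (fun k => by
        rw [Pi.sub_apply, ← neg_sub]; exact (I ^ r).neg_mem (hcc' k)) i)
  obtain ⟨z, ⟨hzI, hfix⟩, -⟩ := existsUnique_fixedPoint_of_contracting I T hT₀ hT
  refine ⟨z, hzI, fun j => ?_⟩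
  -- from the fixed point: `J z = d (η - Q♯(ext z))`
  have hJz : J *ᵥ z = d • (η - fun j => adicEval I (ext z) (Qs j)) := by
    conv_lhs => rw [← hfix]
    simp only [T]
    rw [Matrix.mulVec_mulVec, Matrix.mul_adjugate, Matrix.smul_mulVec, Matrix.one_mulVec]
  have hJzj : ∑ k, J j k * (d * z k) = d * (d * (η j - adicEval I (ext z) (Qs j))) := by
    have := congrFun hJz j
    simp only [Matrix.mulVec, dotProduct, Pi.smul_apply, smul_eq_mul, Pi.sub_apply] at this
    simp_rw [← mul_assoc, mul_comm (J j _) d, mul_assoc, ← Finset.mul_sum, this]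
  -- the point `w = ext (d • z) = d • ext z`, with coordinates in `I`
  have hw : (fun i => if h : ∃ k, ι k = i then d * z h.choose else 0) = ext (d • z) := by
    funext i
    by_cases hi : ∃ k, ι k = i
    · simp only [ext, dif_pos hi, Pi.smul_apply, smul_eq_mul]
    · simp only [ext, dif_neg hi]
  have hzext : ∀ i, ext z i ∈ I := hextI z hzI
  have hwI : ∀ i, ext (d • z) i ∈ I :=
    hextI (d • z) fun k => by rw [Pi.smul_apply, smul_eq_mul]; exact I.mul_mem_left _ (hzI k)
  rw [hw]
  -- decompose `S_j = S_j(0) + Σ_i c_i X_i + Q_j` and evaluate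
  have hS : S j = C (constantCoeff (S j)) + (∑ i, C (coeff (Finsupp.single i 1) (S j)) * X i)
      + Q j := by
    simp only [Q]; ring
  have heval : adicEval I (ext (d • z)) (S j) =
      constantCoeff (S j) + ∑ i, coeff (Finsupp.single i 1) (S j) * ext (d • z) i
        + adicEval I (ext (d • z)) (Q j) := by
    conv_lhs => rw [hS]
    rw [adicEval_add hwI, adicEval_add hwI, adicEval_C, adicEval_sum hwI]
    simp_rw [adicEval_C_mul hwI, adicEval_X]
  -- the linear part only sees the directions `ι`
  have hlin : ∑ i, coeff (Finsupp.single i 1) (S j) * ext (d • z) i = ∑ k, J j k * (d * z k) := by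
    rw [← Finset.sum_subset (Finset.subset_univ (Finset.univ.map ι))]
    · rw [Finset.sum_map]
      refine Finset.sum_congr rfl fun k _ => ?_
      rw [hext_ι, hJ, Matrix.of_apply, Pi.smul_apply, smul_eq_mul]
    · intro i _ hi
      have hi' : ¬ ∃ k, ι k = i := by
        rintro ⟨k, rfl⟩
        exact hi (Finset.mem_map_of_mem ι (Finset.mem_univ k))
      rw [hext_off _ i hi', mul_zero]
  rw [heval, hlin, hJzj, hext_smul, adicEval_smul_eq_sq_mul hzext d (Q j) (Qs j) (hQQs j)]
  ring

end Literature.RingTheory.HenselLemma
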